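import Literature.NumberTheory.Automorphic.QuaternionIdealCountFactorization
import Literature.NumberTheory.Automorphic.QuaternionLocalDensityComparison
import Literature.NumberTheory.Automorphic.QuaternionLocalEichlerReduction
import Literature.NumberTheory.Automorphic.ShimuraCurveCovolume
import Literature.NumberTheory.Automorphic.ShimuraCurveFiniteVolume
import Literature.NumberTheory.Automorphic.ShimuraCurveDivisionLattice
import Literature.NumberTheory.Automorphic.EichlerZetaMeanValue
import Literature.NumberTheory.Automorphic.QuaternionLocalEichlerPair
import Literature.NumberTheory.Automorphic.EichlerOrderLocallyMaximal
import Literature.NumberTheory.Automorphic.QuaternionLocalRamified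
import Literature.NumberTheory.Automorphic.QuaternionLocalSplitIdealCount
import Literature.NumberTheory.EllipticCurves.NewformPeterssonSizeSymmSquareProofs
import HarnessLib

/-!
# The number of integral ideals of norm `≤ T` of an Eichler order of level `M` in the
# quaternion algebra of discriminant `D > 1`: `∑_{n ≤ T} a(n) ∼ (π²/12) · φ(D) ψ(M) / (D M) · T²`

Topic `NumberTheory/Automorphic`; theorems only (no definition, no named fact, no instance).
For a Shimura curve datum `X : ShimuraCurveData D M` (`ShimuraCurve.lean`) with `D > 1` and
`M ≥ 1` — so `B = X.B` is a division quaternion algebra of discriminant `D` and `O = X.O` an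
Eichler order of level `M` — let `a(n)` be the number of invertible (= locally principal) right
`O`-ideals `I ⊆ O` of reduced norm `n` (index `[O : I] = n²`). Then

  `T⁻² ∑_{n ≤ T} a(n) ⟶ (π² / 12) · φ(D) ψ(M) / (D M)`   (`T → ∞` through the integers),

`φ` Euler's function and `ψ(M) = [SL₂(ℤ) : Γ₀(M)] = M ∏_{p ∣ M} (1 + 1/p)` (`gamma0Index`)
(`ShimuraCurveData.tendsto_sum_card_integralIdeals_div_sq`). This is the residue of the zeta
function of the order, `ζ_O(s) = ∑ a(n) n^{-2s} = ζ(2s) ζ(2s - 1) ∏_{p ∣ DM} (local factors)`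
(Vignéras, LNM 800, Ch. III §5 ex. 5.8, Ch. V §2; Eichler; Voight (25.3.7), §26.4), obtained
here Tauberian-free from the tree's mean-value theorem for multiplicative functions which are
`σ₁` at almost all primes (`tendsto_sum_div_sq_of_multiplicative`, `EichlerZetaMeanValue.lean`):

* `a` is multiplicative with `a(p^k) = a_p(k)`, the number of principal right ideals of `O₍ₚ₎`
  of index `p^{2k}` (`QuaternionIdealCountFactorization.lean`);
* `p ∤ D M`: `O₍ₚ₎ ≅ M₂(ℤ_p)` (locally maximal, split) and `a(p^k) = σ₁(p^k)`
  (`card_principal_ideals_of_split`);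
* `p ∣ D`: `O₍ₚ₎` is the valuation ring of the division algebra `B_p` and
  `∑_k a(p^k) p^{-2k} = (1 - p⁻²)⁻¹` (`hasSum_card_principal_div_pow_of_ramified`), local factor
  `(1 - p⁻²)(1 - p⁻¹)(1 - p⁻²)⁻¹ = 1 - p⁻¹`;
* `p ∣ M`: `O₍ₚ₎` is the local Eichler order of level `p^e`, `e = v_p(M) ≥ 1`
  (`exists_eichler_model`), `|O₍ₚ₎ˣ mod p| = p²(p - 1)²` (`ncard_image_stabilizer_of_eichler`)
  and the norm-level density decays (`tendsto_density_normLevel_compl_of_le` from the maximal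
  order), so `∑_k a(p^k) p^{-2k} = p⁴ / (p² (p - 1)²) = (1 - p⁻¹)⁻²`
  (`hasSum_card_principal_div_pow`), local factor `1 + p⁻¹`;

and `∏_{p ∣ D} (1 - p⁻¹) = φ(D)/D`, `∏_{p ∣ M} (1 + p⁻¹) = ψ(M)/M`. It is the arithmetic half of
Eichler's lattice-point method for the covolume of `Γ₀^D(M)`
(`Literature.NumberTheory.Automorphic.ShimuraCurveData.volume_fd_eq`).

## References

* M.-F. Vignéras, *Arithmétique des algèbres de quaternions*, LNM 800 (1980), Ch. II §§1–2,
  Ch. III §5 exercice 5.8, Ch. V §2 [VignerasLNM800].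
* J. Voight, *Quaternion Algebras*, GTM 288 (2021), (25.3.7), §26.4, Lemma 26.6.7 [Voight2021].
-/

open Filter Finset
open scoped Pointwise Topology Real

namespace Literature.NumberTheory.Automorphic

namespace ShimuraCurveData

variable {D M : ℕ} (X : ShimuraCurveData D M)

/-! ### The level is prime to the discriminant -/

/-- `X.O` is an Eichler order of level `M` in the sense of `BrandtModule.lean`. [folklore] -/
theorem isEichlerOrder' : IsEichlerOrder X.O M := isEichlerOrder_iff_brandt.mpr X.isEichlerOrder

/-- The quaternion algebra of a datum with `D > 1` is a division algebra. [folklore] -/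
theorem forall_isUnit (hD : 1 < D) : ∀ x : X.B, x ≠ 0 → IsUnit x :=
  fun x hx => X.isUnit_of_ne_zero hD x hx

/-- **`gcd(D, M) = 1`**: a prime dividing the discriminant does not divide the level (at a
ramified prime the two maximal orders `O₁, O₂` with `O = O₁ ∩ O₂` agree locally, so the index
`[O₁ : O] = M` has no `p`-part). [cite: VignerasLNM800, Ch. III §5 (ordres d'Eichler)] -/
theorem not_dvd_level_of_dvd_disc (X : ShimuraCurveData D M) (hM : 0 < M) {p : ℕ}
    (hp : p.Prime) (hpD : p ∣ D) :
    ¬ p ∣ M := by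
  haveI : Fact p.Prime := ⟨hp⟩
  obtain ⟨O₁, O₂, hO₁, hO₂, hO, hidx⟩ := X.isEichlerOrder'
  have hT := isUnit_padicTensor_of_dvd X.B X.mem_ramifiedPlaces_iff hpD
  have hloc : localAt p X.O = localAt p O₁ := by
    rw [hO]; exact localAt_inf_eq_of_padic_division hO₁ hO₂ hT
  have hle : X.O ≤ O₁ := hO ▸ inf_le_left
  have h := relIndex_localAt (p := p) O₁ X.O hle (by rw [hidx]; exact hM.ne')
  rw [hloc, AddSubgroup.relIndex_self, hidx] at h
  intro hpM
  have h1 : 1 ≤ M.factorization p := (hp.dvd_iff_one_le_factorization hM.ne').mp hpM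
  have : p ^ 1 ≤ p ^ M.factorization p := Nat.pow_le_pow_right hp.pos h1
  rw [← h, pow_one] at this
  exact absurd this (not_le.mpr hp.one_lt)

/-- `D` and `M` are coprime (when a Shimura curve datum with `D > 1`, `M ≥ 1` exists). [folklore] -/
theorem coprime_disc_level (X : ShimuraCurveData D M) (hM : 0 < M) : D.Coprime M := by
  refine Nat.coprime_of_dvd fun p hp hpD hpM => ?_
  exact X.not_dvd_level_of_dvd_disc hM hp hpD hpM

/-! ### The local factors -/

/-- **`a(p^k) = σ₁(p^k)` at `p ∤ D M`**: the Eichler order is maximal at `p` and `B` splits at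
`p`, so the principal right ideals of `O₍ₚ₎ ≅ M₂(ℤ_p)` of index `p^{2k}` are counted by the
Hermite normal forms (`card_principal_ideals_of_split`). [cite: VignerasLNM800, Ch. II §2 Thm. 2.3 (3)] -/
theorem card_integralIdeals_prime_pow_of_not_dvd (hD : 1 < D) (hM : 0 < M) {p : ℕ} (hp : p.Prime)
    (hpD : ¬ p ∣ D) (hpM : ¬ p ∣ M) (k : ℕ) :
    Nat.card {I : invertibleRightIdeals X.O // (I : Submodule ℤ X.B) ≤ X.O ∧
        (I : Submodule ℤ X.B).toAddSubgroup.relIndex X.O.toAddSubgroup = (p ^ k) ^ 2} =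
      ∑ i ∈ range (k + 1), p ^ i := by
  haveI : Fact p.Prime := ⟨hp⟩
  have hdiv := X.forall_isUnit hD
  obtain ⟨O₁, hO₁, -, hloc⟩ := X.isEichlerOrder'.exists_isMaximalZOrder_localAt_eq hM.ne' hp hpM
  obtain ⟨φ⟩ := exists_algHom_matrix_of_not_dvd X.mem_ramifiedPlaces_iff hpD
  obtain ⟨u, hu⟩ := hO₁.exists_conjUnit_localAt_iff hdiv φ
  have hΛ : ∀ x : X.B, x ∈ localAt p X.O ↔ ∀ i j, ‖AlgHom.conjUnit φ u x i j‖ ≤ 1 := fun x => by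
    rw [hloc]; exact hu x
  rw [card_integralIdeals_prime_pow hdiv X.isZOrder hp k,
    card_principal_ideals_of_split hdiv (AlgHom.conjUnit φ u) X.isZOrder hΛ k]

/-- **The local factor at `p ∣ D`**: `∑_k a(p^k) p^{-2k} = p⁴ / (p⁴ - p²)` (the Eichler order is
maximal at `p`, where `B_p` is a division algebra and `O₍ₚ₎ = {nrd ∈ ℤ₍ₚ₎}`).
[cite: VignerasLNM800, Ch. II §1 Lemme 1.4] [cite: Voight2021, §26.4] -/
theorem hasSum_card_integralIdeals_of_dvd_disc (hD : 1 < D) {p : ℕ} (hp : p.Prime) (hpD : p ∣ D) :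
    HasSum (fun k => (Nat.card {I : invertibleRightIdeals X.O // (I : Submodule ℤ X.B) ≤ X.O ∧
        (I : Submodule ℤ X.B).toAddSubgroup.relIndex X.O.toAddSubgroup = (p ^ k) ^ 2} : ℝ) /
        (p : ℝ) ^ (2 * k))
      ((p : ℝ) ^ 4 / ((p : ℝ) ^ 4 - (p : ℝ) ^ 2)) := by
  haveI : Fact p.Prime := ⟨hp⟩
  have hdiv := X.forall_isUnit hD
  have hT := isUnit_padicTensor_of_dvd X.B X.mem_ramifiedPlaces_iff hpD
  obtain ⟨O₁, hO₁, -, hloc⟩ := X.isEichlerOrder'.exists_isMaximalZOrder_localAt_eq_of_padic_division hT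
  have hΛ : ∀ x : X.B, x ∈ localAt p X.O ↔ ¬ p ∣ (reducedNorm ℚ X.B x).den := fun x => by
    rw [hloc]; exact hO₁.mem_localAt_iff_of_ramified hdiv hT x
  have h := hasSum_card_principal_div_pow_of_ramified hdiv X.isZOrder hΛ
  convert h using 1
  funext k
  rw [card_integralIdeals_prime_pow hdiv X.isZOrder hp k]

/-- **The local factor at `p ∣ M`**: `∑_k a(p^k) p^{-2k} = p⁴ / (p² (p - 1)²) = (1 - p⁻¹)⁻²`
(the local Eichler order of level `p^e`, `e ≥ 1`: unit count `p² (p - 1)²` and decay of the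
norm-level density inherited from the maximal order). [cite: VignerasLNM800, Ch. II §2 Thm. 2.3 (2)] [cite: Voight2021, Lemma 26.6.7] -/
theorem hasSum_card_integralIdeals_of_dvd_level (hD : 1 < D) (hM : 0 < M) {p : ℕ} (hp : p.Prime)
    (hpM : p ∣ M) :
    HasSum (fun k => (Nat.card {I : invertibleRightIdeals X.O // (I : Submodule ℤ X.B) ≤ X.O ∧
        (I : Submodule ℤ X.B).toAddSubgroup.relIndex X.O.toAddSubgroup = (p ^ k) ^ 2} : ℝ) /
        (p : ℝ) ^ (2 * k))
      ((p : ℝ) ^ 4 / ((p : ℝ) ^ 2 * ((p : ℝ) - 1) ^ 2)) := by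
  haveI : Fact p.Prime := ⟨hp⟩
  have hdiv := X.forall_isUnit hD
  have hpD : ¬ p ∣ D := fun h => X.not_dvd_level_of_dvd_disc hM hp h hpM
  obtain ⟨O₁, O₂, hO₁, hO₂, hO, hidx⟩ := X.isEichlerOrder'
  obtain ⟨φ⟩ := exists_algHom_matrix_of_not_dvd X.mem_ramifiedPlaces_iff hpD
  obtain ⟨Ψ, e, hΛ₁, hΛe⟩ := exists_eichler_model hdiv hO₁ hO₂ φ
  have hΛ : ∀ x : X.B, x ∈ localAt p X.O ↔
      (∀ i j, ‖Ψ x i j‖ ≤ 1) ∧ ‖Ψ x 1 0‖ ≤ (p : ℝ) ^ (-(e : ℤ)) := fun x => by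
    rw [hO]; exact hΛe x
  have hle : X.O ≤ O₁ := hO ▸ inf_le_left
  have hidx0 : X.O.toAddSubgroup.relIndex O₁.toAddSubgroup ≠ 0 := by rw [hidx]; exact hM.ne'
  -- `e ≥ 1` since `p ∣ M`
  have he : 1 ≤ e := by
    by_contra he0
    have he0' : e = 0 := by omega
    have hloc : localAt p X.O = localAt p O₁ := by
      ext x
      rw [hΛ, hΛ₁, he0']
      simp only [CharP.cast_eq_zero, neg_zero, zpow_zero]
      exact ⟨fun h => h.1, fun h => ⟨h, h 1 0⟩⟩
    have h := relIndex_localAt (p := p) O₁ X.O hle hidx0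
    rw [hloc, AddSubgroup.relIndex_self, hidx] at h
    have h1 : 1 ≤ M.factorization p := (hp.dvd_iff_one_le_factorization hM.ne').mp hpM
    have : p ^ 1 ≤ p ^ M.factorization p := Nat.pow_le_pow_right hp.pos h1
    rw [← h, pow_one] at this
    exact absurd this (not_le.mpr hp.one_lt)
  -- decay of the density and the unit count
  have hY := tendsto_density_normLevel_compl_of_le X.isZOrder hO₁.1 hle hidx0
    (tendsto_density_normLevel_compl_of_split hdiv Ψ hO₁.1 hΛ₁)
  have h := X.isZOrder.hasSum_card_principal_div_pow hY
  rw [ncard_image_stabilizer_of_eichler hdiv Ψ X.isZOrder he hΛ] at h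
  have hcast : (((p ^ 2 * (p - 1) ^ 2 : ℕ)) : ℝ) = (p : ℝ) ^ 2 * ((p : ℝ) - 1) ^ 2 := by
    push_cast [Nat.cast_sub hp.one_le]
    ring
  rw [hcast] at h
  convert h using 1
  funext k
  rw [card_integralIdeals_prime_pow hdiv X.isZOrder hp k]

/-! ### The Euler product of the bad factors -/

/-- **The bad Euler factors multiply to `φ(D) ψ(M) / (D M)`**:
`∏_{p ∣ D} (1-p⁻²)(1-p⁻¹)·p⁴/(p⁴-p²) · ∏_{p ∣ M} (1-p⁻²)(1-p⁻¹)·p⁴/(p²(p-1)²)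
 = ∏_{p ∣ D} (1 - p⁻¹) · ∏_{p ∣ M} (1 + p⁻¹) = (φ(D)/D) (ψ(M)/M)`. [folklore] -/
theorem prod_badFactors_eq {D M : ℕ} (hD0 : D ≠ 0) (hM0 : M ≠ 0) (hcop : D.Coprime M) :
    ∏ p ∈ D.primeFactors ∪ M.primeFactors, ((1 - ((p : ℝ) ^ 2)⁻¹) * (1 - (p : ℝ)⁻¹) *
        (if p ∣ D then (p : ℝ) ^ 4 / ((p : ℝ) ^ 4 - (p : ℝ) ^ 2)
         else (p : ℝ) ^ 4 / ((p : ℝ) ^ 2 * ((p : ℝ) - 1) ^ 2))) =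
      (Nat.totient D : ℝ) / D * ((Literature.NumberTheory.EllipticCurves.ModularForms.gamma0Index M : ℝ) / M) := by
  rw [Finset.prod_union hcop.disjoint_primeFactors]
  have hDprod : ∏ p ∈ D.primeFactors, ((1 - ((p : ℝ) ^ 2)⁻¹) * (1 - (p : ℝ)⁻¹) *
      (if p ∣ D then (p : ℝ) ^ 4 / ((p : ℝ) ^ 4 - (p : ℝ) ^ 2)
       else (p : ℝ) ^ 4 / ((p : ℝ) ^ 2 * ((p : ℝ) - 1) ^ 2))) =
      ∏ p ∈ D.primeFactors, (1 - (p : ℝ)⁻¹) := by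
    refine Finset.prod_congr rfl fun p hp => ?_
    have hpp : p.Prime := Nat.prime_of_mem_primeFactors hp
    have hpd : p ∣ D := Nat.dvd_of_mem_primeFactors hp
    rw [if_pos hpd]
    have hp0 : (p : ℝ) ≠ 0 := by exact_mod_cast hpp.ne_zero
    have hp2 : (1 : ℝ) < (p : ℝ) ^ 2 := by
      have : (1 : ℝ) < p := by exact_mod_cast hpp.one_lt
      nlinarith
    have hp21 : (p : ℝ) ^ 2 - 1 ≠ 0 := by nlinarith
    rw [show (p : ℝ) ^ 4 - (p : ℝ) ^ 2 = (p : ℝ) ^ 2 * ((p : ℝ) ^ 2 - 1) by ring,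
      show 1 - ((p : ℝ) ^ 2)⁻¹ = ((p : ℝ) ^ 2 - 1) / (p : ℝ) ^ 2 by field_simp]
    field_simp
  have hMprod : ∏ p ∈ M.primeFactors, ((1 - ((p : ℝ) ^ 2)⁻¹) * (1 - (p : ℝ)⁻¹) *
      (if p ∣ D then (p : ℝ) ^ 4 / ((p : ℝ) ^ 4 - (p : ℝ) ^ 2)
       else (p : ℝ) ^ 4 / ((p : ℝ) ^ 2 * ((p : ℝ) - 1) ^ 2))) =
      ∏ p ∈ M.primeFactors, (1 + (p : ℝ)⁻¹) := by
    refine Finset.prod_congr rfl fun p hp => ?_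
    have hpp : p.Prime := Nat.prime_of_mem_primeFactors hp
    have hpm : p ∣ M := Nat.dvd_of_mem_primeFactors hp
    have hpd : ¬ p ∣ D := fun h =>
      hpp.one_lt.ne' (Nat.Coprime.eq_one_of_dvd (hcop.coprime_dvd_left h) hpm)
    rw [if_neg hpd]
    have hp0 : (p : ℝ) ≠ 0 := by exact_mod_cast hpp.ne_zero
    have hp1 : (p : ℝ) - 1 ≠ 0 := by
      have : (1 : ℝ) < p := by exact_mod_cast hpp.one_lt
      linarith
    field_simp
    ring
  rw [hDprod, hMprod]
  -- `∏_{p ∣ D} (1 - p⁻¹) = φ(D)/D`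
  have hφ : ∏ p ∈ D.primeFactors, (1 - (p : ℝ)⁻¹) = (Nat.totient D : ℝ) / D := by
    have h := Nat.totient_eq_mul_prod_factors D
    have h' : ((Nat.totient D : ℚ) : ℝ) = ((D * ∏ p ∈ D.primeFactors, (1 - (p : ℚ)⁻¹) : ℚ) : ℝ) := by
      rw [h]
    push_cast at h'
    have hD0' : (D : ℝ) ≠ 0 := by exact_mod_cast hD0
    rw [h', mul_div_cancel_left₀ _ hD0']
  -- `∏_{p ∣ M} (1 + p⁻¹) = ψ(M)/M`
  have hψ : ∏ p ∈ M.primeFactors, (1 + (p : ℝ)⁻¹) =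
      (Literature.NumberTheory.EllipticCurves.ModularForms.gamma0Index M : ℝ) / M := by
    have hM0' : (M : ℝ) ≠ 0 := by exact_mod_cast hM0
    rw [Literature.NumberTheory.EllipticCurves.ModularForms.gamma0Index_eq_mul_prod hM0, mul_div_cancel_left₀ _ hM0']
  rw [hφ, hψ]

/-! ### The asymptotic count of integral ideals -/

/-- **`∑_{n ≤ T} a(n) / T² → (π²/12) φ(D) ψ(M) / (D M)`** for the Eichler order `O` of level `M`
of the quaternion algebra of discriminant `D > 1` underlying a Shimura curve datum: the number
`a(n)` of invertible right `O`-ideals `I ⊆ O` of norm `n` (index `n²`) has mean value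
`(π²/12) φ(D) ψ(M) / (DM)` (residue of the zeta function of `O`: Vignéras V §2 / Eichler's
computation; here from multiplicativity and the three local factors). [cite: VignerasLNM800, Ch. V §2 and Ch. III §5 exercice 5.8] [cite: Voight2021, (25.3.7), §26.4] -/
theorem tendsto_sum_card_integralIdeals_div_sq (hD : 1 < D) (hM : 0 < M) :
    Tendsto (fun N : ℕ => (∑ n ∈ Icc 1 N, (Nat.card {I : invertibleRightIdeals X.O //
        (I : Submodule ℤ X.B) ≤ X.O ∧
          (I : Submodule ℤ X.B).toAddSubgroup.relIndex X.O.toAddSubgroup = n ^ 2} : ℝ)) / (N : ℝ) ^ 2)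
      atTop (𝓝 (π ^ 2 / 12 * ((Nat.totient D : ℝ) / D *
        ((Literature.NumberTheory.EllipticCurves.ModularForms.gamma0Index M : ℝ) / M)))) := by
  classical
  have hdiv := X.forall_isUnit hD
  have hD0 : D ≠ 0 := by omega
  set a : ℕ → ℕ := fun n => Nat.card {I : invertibleRightIdeals X.O // (I : Submodule ℤ X.B) ≤ X.O ∧
    (I : Submodule ℤ X.B).toAddSubgroup.relIndex X.O.toAddSubgroup = n ^ 2} with ha
  set S : Finset ℕ := D.primeFactors ∪ M.primeFactors with hS
  set A : ℕ → ℝ := fun p => if p ∣ D then (p : ℝ) ^ 4 / ((p : ℝ) ^ 4 - (p : ℝ) ^ 2)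
    else (p : ℝ) ^ 4 / ((p : ℝ) ^ 2 * ((p : ℝ) - 1) ^ 2) with hA
  have ha1 : a 1 = 1 := by
    rw [ha]; exact card_integralIdeals_one hdiv X.isZOrder
  have hmul : ∀ m n, m.Coprime n → a (m * n) = a m * a n := fun m n hmn =>
    card_integralIdeals_mul_of_coprime hdiv X.isZOrder m n hmn
  have hSprime : ∀ p ∈ S, p.Prime := by
    intro p hp
    rcases Finset.mem_union.mp hp with h | h <;> exact Nat.prime_of_mem_primeFactors h
  have hgood : ∀ p, p.Prime → p ∉ S → ∀ k, a (p ^ k) = ∑ i ∈ range (k + 1), p ^ i := by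
    intro p hp hpS k
    have hpD : ¬ p ∣ D := fun h => hpS (Finset.mem_union_left _ (Nat.mem_primeFactors.mpr ⟨hp, h, hD0⟩))
    have hpM : ¬ p ∣ M := fun h => hpS (Finset.mem_union_right _ (Nat.mem_primeFactors.mpr ⟨hp, h, hM.ne'⟩))
    exact X.card_integralIdeals_prime_pow_of_not_dvd hD hM hp hpD hpM k
  have hbad : ∀ p ∈ S, HasSum (fun k => (a (p ^ k) : ℝ) / (p : ℝ) ^ (2 * k)) (A p) := by
    intro p hp
    have hpp := hSprime p hp
    by_cases hpD : p ∣ D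
    · rw [hA]; simp only [if_pos hpD]
      exact X.hasSum_card_integralIdeals_of_dvd_disc hD hpp hpD
    · have hpM : p ∣ M := by
        rcases Finset.mem_union.mp hp with h | h
        · exact absurd (Nat.dvd_of_mem_primeFactors h) hpD
        · exact Nat.dvd_of_mem_primeFactors h
      rw [hA]; simp only [if_neg hpD]
      exact X.hasSum_card_integralIdeals_of_dvd_level hD hM hpp hpM
  have h := tendsto_sum_div_sq_of_multiplicative a ha1 hmul S hSprime hgood A hbad
  rw [prod_badFactors_eq hD0 hM.ne' (X.coprime_disc_level hM)] at h
  exact h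

end ShimuraCurveData

end Literature.NumberTheory.Automorphic
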